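import Summits.RiemannHypothesis.RiemannHypothesis.Theses.LiDirichletEcho
import Summits.RiemannHypothesis.RiemannHypothesis.Theorems.LiDirichletEchoResonantTwist
import HarnessLib

/-!
# RiemannHypothesis / LiDirichletEcho — crux K2χ `LiPrimeEdgeEchoChar`: the prime edge of `L(s, χ)` is the TWISTED echo
# of the prime 2 (RH-FREE, GRH-FREE)

RH-FREE · GRH-FREE [rh-li-eng g5, acting as prover on the unstaffed route].  Route `Theses/LiDirichletEcho.lean` (rung
«Li PRIME-ECHO LAW FOR DIRICHLET CHARACTERS» `LiTheory.LiZeroWindowEchoDirichlet`, L-P(P1χ); cell `pub/rh-li`, dossier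
`theory/route/p5`), item `LiPrimeEdgeEchoChar` (stmt-RiemannHypothesis-19393, the deciding crux): for every Dirichlet
character `χ` mod `q` (primitivity and `q > 1` are not used) and every `c ≥ 5/4` there are `N, C` with

  `|charPrimeEdge χ n T₁ T₂ − liPrimeEchoTwist (χ 2) 2 n| ≤ C log² n`   (`n ≥ N`, `√n ≤ T₁ ≤ √n + 1`, `c√n ≤ T₂ ≤ c√n + 1`).

Composition (the birth skeleton's `LiPrimeEdgeEchoChar_of_stubs`, planner rh-li-theory g7) of stub E₁χ
(`CharPrimeEdge.charEdgeTwo_resonant`: the `m = 2` term against `F_n(1 − w)` is `χ(2)` times ζ's resonant integral, whose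
COMPLEX value is `π A₂ n^{1/4} e^{−i(2√(n log 2)+π/4)} + O_c(log n)`, and `Re[χ(2)·chirp]/π = liPrimeEchoTwist (χ 2) 2 n`
— the typed convention `χ(2)`, NOT `χ̄(2)`, as the cell's certified guard row DATA.md §N found) with stub E₂χ
(`CharPrimeEdge.charPrimeEdge_nonresonant`: everything else is `O_c(1)` by the ζ route's first-derivative tests with
`‖χ(m)‖ ≤ 1`): `C' + C log n ≤ (C'/log² 2 + C/log 2) log² n` for `n ≥ 16`.  The constants do not depend on `χ` or `q`.
The statement is about the prime-power side of the explicit formula on `Re w = 3/2`; nothing here bears on the truth of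
RH or GRH.
-/

noncomputable section

-- D-0017: `Summit.<S>.<S>.…` is the designed namespace of a single-problem summit.
set_option linter.dupNamespace false

open Complex MeasureTheory intervalIntegral Set
open scoped Real Interval ArithmeticFunction.vonMangoldt

namespace Summit.RiemannHypothesis.RiemannHypothesis.Theorems.LiTheory

/-- **Crux K2χ `LiPrimeEdgeEchoChar` of route `LiDirichletEcho`, for EVERY character** (stmt-RiemannHypothesis-19393;
RH-FREE, GRH-FREE): for `c ≥ 5/4` there are `N, C` (independent of `χ`) with
`|charPrimeEdge χ n T₁ T₂ − liPrimeEchoTwist (χ 2) 2 n| ≤ C log² n` for `n ≥ N`, `√n ≤ T₁ ≤ √n + 1`, `c√n ≤ T₂ ≤ c√n + 1`. -/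
theorem liPrimeEdgeEchoChar_bound {q : ℕ} :
    ∀ c : ℝ, 5 / 4 ≤ c → ∃ N : ℕ, ∃ C : ℝ, ∀ (χ : DirichletCharacter ℂ q) (n : ℕ), N ≤ n → ∀ T₁ T₂ : ℝ,
      Real.sqrt n ≤ T₁ → T₁ ≤ Real.sqrt n + 1 → c * Real.sqrt n ≤ T₂ → T₂ ≤ c * Real.sqrt n + 1 →
        |charPrimeEdge χ n T₁ T₂ - liPrimeEchoTwist (χ (2 : ZMod q)) 2 n| ≤ C * Real.log n ^ 2 := by
  -- adapted from the birth skeleton's `LiPrimeEdgeEchoChar_of_stubs` (planner rh-li-theory g7, HOME/theory/route/p5/bc)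
  intro c hc
  have hc1 : (1 : ℝ) ≤ c := by linarith
  obtain ⟨N, C, hN⟩ := CharPrimeEdge.charEdgeTwo_resonant (q := q) hc
  obtain ⟨C', hC'⟩ := CharPrimeEdge.charPrimeEdge_nonresonant (q := q) hc1
  set ℓ : ℝ := Real.log 2 with hℓ_def
  have hℓ : 0 < ℓ := Real.log_pos (by norm_num)
  refine ⟨max N 16, |C'| / ℓ ^ 2 + |C| / ℓ, fun χ n hn T₁ T₂ h1 h2 h3 h4 ↦ ?_⟩
  have hnN : N ≤ n := le_trans (le_max_left _ _) hn
  have hn2 : 2 ≤ n := le_trans (by norm_num) (le_trans (le_max_right _ _) hn)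
  have hn16 : (16 : ℝ) ≤ n := by exact_mod_cast le_trans (le_max_right _ _) hn
  have hs0 : 0 ≤ Real.sqrt n := Real.sqrt_nonneg _
  have hs4 : 4 ≤ Real.sqrt n := by
    have : Real.sqrt 16 = 4 := by
      rw [show (16 : ℝ) = 4 ^ 2 by norm_num]; exact Real.sqrt_sq (by norm_num)
    rw [← this]; exact Real.sqrt_le_sqrt hn16
  have hgap : 1 ≤ (c - 1) * Real.sqrt n := by
    have := mul_le_mul (show (1 / 4 : ℝ) ≤ c - 1 by linarith) hs4 (by norm_num) (by linarith)
    linarith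
  have h12 : T₁ ≤ T₂ := by nlinarith
  have hA := hN χ n hnN T₁ T₂ h1 h2 h3 h4
  have hB := hC' χ n (by omega) T₁ T₂ h1 h12 h4
  set L : ℝ := Real.log n with hL_def
  have hLℓ : ℓ ≤ L := Real.log_le_log (by norm_num) (by exact_mod_cast hn2)
  have hL0 : 0 ≤ L := hℓ.le.trans hLℓ
  have hL1 : (1 : ℝ) ≤ L ^ 2 / ℓ ^ 2 := by
    rw [one_le_div (by positivity)]; exact pow_le_pow_left₀ hℓ.le hLℓ 2
  have hL2 : L ≤ L ^ 2 / ℓ := by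
    rw [le_div_iff₀ hℓ, sq]; exact mul_le_mul_of_nonneg_left hLℓ hL0
  have b1 : C' ≤ |C'| * (L ^ 2 / ℓ ^ 2) := (le_abs_self C').trans (le_mul_of_one_le_right (abs_nonneg _) hL1)
  have b2 : C * L ≤ |C| * (L ^ 2 / ℓ) :=
    (mul_le_mul_of_nonneg_right (le_abs_self C) hL0).trans (mul_le_mul_of_nonneg_left hL2 (abs_nonneg _))
  have e : (|C'| / ℓ ^ 2 + |C| / ℓ) * L ^ 2 = |C'| * (L ^ 2 / ℓ ^ 2) + |C| * (L ^ 2 / ℓ) := by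
    field_simp
  rw [e]
  have htri := abs_sub_le (charPrimeEdge χ n T₁ T₂) (CharPrimeEdge.charEdgeTwo χ n T₁ T₂)
    (liPrimeEchoTwist (χ (2 : ZMod q)) 2 n)
  linarith

/-- **Item `LiPrimeEdgeEchoChar` of route `LiDirichletEcho`** (stmt-RiemannHypothesis-19393, deciding crux K2χ), closed
BY NAME (the hypotheses `χ.IsPrimitive`, `1 < q` of the route statement are not needed). -/
theorem liPrimeEdgeEchoChar_proof :
    Summit.RiemannHypothesis.RiemannHypothesis.Theses.LiDirichletEcho.LiPrimeEdgeEchoChar := by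
  intro q _ χ _ _ c hc
  obtain ⟨N, C, h⟩ := liPrimeEdgeEchoChar_bound (q := q) c hc
  exact ⟨N, C, fun n hn T₁ T₂ h1 h2 h3 h4 ↦ h χ n hn T₁ T₂ h1 h2 h3 h4⟩

end Summit.RiemannHypothesis.RiemannHypothesis.Theorems.LiTheory
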